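import Summits.QuantumFields.YangMills.Theorems.UnitScaleTiltFluctuationComparisonRegPrGlobalSlackLegNaturalRowsTwoRunCrux
import Summits.QuantumFields.YangMills.Theorems.UnitScaleTiltMinimiserStabilityRegPrStubHalvingStep
import HarnessLib

/-!
# `UnitScaleTiltFluctuationComparisonRegPrIntCruxOfHalvingStub` — THE DECIDING CRUX `FluctuationComparisonRegPrIntL` (stmt-QuantumFields-20520) WITH THE H LEAF DISCHARGED BY NAME:
# 20520 ⇐ {EX} + ONE RECORD-WITH-PRINT-ROWS HYPOTHESIS PER ODD BLOCK SIZE (count-neutral display re-base of ✓p643381; `--supports stmt-QuantumFields-20520 --as helper`)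

Cell `ym3-torus` (HUMAN RULING D-0037: YM₃ on T³ is ladder rung R3 — NOT d = 4, NOT infinite volume, NOT a mass gap, NOT the Clay problem), width seat `ym-ust-20520-w5`
gen 10.  THEOREMS ONLY (0 `def`, 0 `sorry`); registry ∕ skeleton texts ∕ `closes` untouched; nothing here claims 20520, EX, the crux or the gap.

WHY.  ym-ust-20520-w2 g5's ✓p643381 `InteriorExcision.regPrIntL_of_halving_exist_recChiV4WithPrintRowsLip_allL (hV2) (hEX) (h2P)` displays 20520 from the TEXTS of
19200's two registered stubs `stub_halvingStep` (H, = `hV2`) and `stub_existenceMinimalOrbit` (EX, = `hEX`) VERBATIM plus one record-with-print-rows hypothesis `h2P` per odd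
`L`.  The H text is now a THEOREM of the tree — LEAD-H ym-ust-19200-w5's `MinimiserStabilityRegPrStubHalvingStep.stub_halvingStep` (door ρ5 ✓p687803 ∘ room ✓p687759 ∘
K-final ✓p699757 ∘ the Stokes-row closure ∘ B-al (b)-row) — so the `hV2` leaf is discharged BY NAME:

* ★★★ **`InteriorExcision.regPrIntL_of_exist_recChiV4WithPrintRowsLip_allL (hEX) (h2P) : FluctuationComparisonRegPrIntL`**.

DEPENDENCY MAP OF 20520 AT THE NATURAL OBJECTS after this file: {EX (19200's `stub_existenceMinimalOrbit`, display S29ᴸ)} + ONE record-level package per odd `L` = NODE-O's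
2′χ(v4) record together with, at its own constants, the definer rows (43)∕(K_b)∕(ℓ)∕(k₀)∕(New) and the two UNPRINTED two-cut-off estimates (K₀) + (Fine_b) of
non-abelian `d = 3` (all exactly as lettered in ✓p643381 — the binder texts below are its `hEX`∕`h2P` VERBATIM).

HONEST SCOPE.  A one-line composition of landed theorems; every listed row is a HYPOTHESIS; nothing of [Balaban1985UV3] ∕ [Balaban1985Variational] ∕ [King1986] is
asserted; 20520 stays OPEN; no summit ∕ rung ∕ gap claim.  L-floor: none (every odd `L > 1`).

References: T. Bałaban, CMP 102 (1985) 277–309 [Balaban1985Variational] (Thm 1 (8) p.279, Prop. 7 p.299, Prop. 8 p.304, Sect. F p.304); CMP 102 (1985) 255–275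
[Balaban1985UV3] (p.263 L4, (27)–(30) p.263, (33)–(34) p.264, (41) p.266, (43)–(47) pp.266–267, (57) p.270, (59)–(63) pp.270–272, Thm 2 p.272); C. King, CMP 102 (1986)
649–677 [King1986] (Thm 3.4 (3.9) p.656, Prop. 3.6 (3.56) p.662, Prop. 3.9 (3.71)–(3.74) p.665); CMP 109 (1987) 249–301 [Balaban1987RG1] ((0.1) p.251).
-/

set_option autoImplicit false

noncomputable section

open scoped Matrix.Norms.L2Operator Nat
open Literature.MathematicalPhysics.QuantumFieldTheory.Balaban1983to89
open Literature.MathematicalPhysics.QuantumFieldTheory.Balaban1983to89.T3ContinuumYM3Torus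
open Literature.MathematicalPhysics.QuantumFieldTheory.Balaban1983to89.T3UnitLawDensityEML (ℰp)
open Literature.MathematicalPhysics.QuantumFieldTheory.Balaban1983to89.T3UnitScaleTilt (θBal)
open Literature.MathematicalPhysics.QuantumFieldTheory.Balaban1983to89.T3LevelShift (fieldShift)
open Literature.MathematicalPhysics.QuantumFieldTheory.Balaban1983to89.T3AlphaInputsAC (AlphaDataT3)
open Literature.MathematicalPhysics.QuantumFieldTheory.Balaban1983to89.T3AlphaPolymerSocket (refineSet)
open Literature.MathematicalPhysics.QuantumFieldTheory.Balaban1983to89.TreeLengthTorus (tsys)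
open Literature.MathematicalPhysics.QuantumFieldTheory.Balaban1983to89.B10Eq27TorusAxialLog
open Literature.MathematicalPhysics.QuantumFieldTheory.Balaban1983to89.B7Prop1Explicit (l1)
open Literature.MathematicalPhysics.QuantumFieldTheory.Balaban1983to89.ExpMeanLog (deltaSU deltaSU_pos)
open Literature.MathematicalPhysics.QuantumFieldTheory.Balaban1985CMP102
open Literature.MathematicalPhysics.QuantumFieldTheory.Balaban1985CMP102.Setting
open Literature.MathematicalPhysics.QuantumFieldTheory.Balaban1985CMP102.Binders (ChartAnalyticityAsCited)
open Summit.QuantumFields.Balaban3D.Carriers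
open Summit.QuantumFields.Balaban3D.Proofs.Primitives
open Summit.QuantumFields.Balaban3D.Proofs.GroupModelLieC (vecE lieC)
open Summit.QuantumFields.YangMills.Theorems
open Summit.QuantumFields.YangMills.Theorems.GlobalSlackKernelMatching
open Summit.QuantumFields.YangMills.Theorems.GlobalSlackCanonicalPolymers

namespace Summit.QuantumFields.YangMills.Theorems.InteriorExcision

open Literature.MathematicalPhysics.QuantumFieldTheory.Balaban1983to89.T3InteriorExcision
open Literature.MathematicalPhysics.QuantumFieldTheory.Balaban1983to89.T3PrintedRegularMinimiser
open Literature.MathematicalPhysics.QuantumFieldTheory.Balaban1983to89.T3PrintedMinimiserExistence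
open Literature.MathematicalPhysics.QuantumFieldTheory.Balaban1983to89.T3SmallLiftHistory
open Literature.MathematicalPhysics.QuantumFieldTheory.Balaban1983to89.T3ConstrainedMinimiser (fibre)
open Literature.MathematicalPhysics.QuantumFieldTheory.Balaban1983to89.T3Thm1Carrier (famX Idx)
open Summit.QuantumFields.YangMills.Theorems.GlobalSlackKernelLeg

/-! ## §1 The crux from the EX leaf and one record-with-print-rows hypothesis — H discharged by name -/

/-- ★★★ **THE DECIDING CRUX FROM 19200's EX LEAF AND ONE RECORD-WITH-PRINT-ROWS HYPOTHESIS PER ODD BLOCK SIZE — THE H LEAF DISCHARGED BY NAME.**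
`FluctuationComparisonRegPrIntL` follows from the text of `stub_existenceMinimalOrbit` (EX) VERBATIM and, for every odd `L > 1`, the record-with-print-rows package `h2P`
of ✓`regPrIntL_of_halving_exist_recChiV4WithPrintRowsLip_allL` VERBATIM; the halving leaf `hV2` of that door (= the registered `stub_halvingStep` text) is supplied by the
tree's theorem `MinimiserStabilityRegPrStubHalvingStep.stub_halvingStep` ([Balaban1985Variational] Sect. F p.304: «hence U_k belongs to the space (2) with max{B₃ε₁, ½ε₀}
instead of ε₀»).  Proof: one `exact`.  Nothing of the listed rows is asserted; no registered stub is restated as proved here; 20520 stays OPEN.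
[cite: Balaban1985Variational, Sect. F p.304, Prop. 7 p.299, Thm 1 (8) p.279; Balaban1985UV3, (43)-(47) pp.266-267, (59)-(63) pp.270-272, Thm 2 p.272; King1986, Prop. 3.6 (3.56) p.662, Prop. 3.9 (3.71)-(3.74) p.665; Balaban1987RG1, (0.1) p.251] -/
theorem regPrIntL_of_exist_recChiV4WithPrintRowsLip_allL
    (hEX : ∀ (L : ℕ), 1 < L → ∀ (B₃ : ℝ), 4 < B₃ → ∃ a₁' O₁ : ℝ, 0 < a₁' ∧ 1 ≤ O₁ ∧
      ∀ (F : T3Family), F.L = L → ∀ (n K : ℕ) (hnK : n < K) (ε₁ : ℝ), 0 < ε₁ →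
        ∀ V : GaugeField (F.P n) 0 (Matrix.specialUnitaryGroup (Fin 2) ℂ), PlaqSmall ε₁ V →
          ∀ U₀ : GaugeField (F.P K) 0 (Matrix.specialUnitaryGroup (Fin 2) ℂ), RegPr F n K ((L : ℝ) ^ 3 * B₃ * ε₁) U₀ → U₀ ∈ fibre F ℰp n K hnK.le V →
            ε₁ ≤ a₁' → ∃ U ∈ regFibrePr F n K hnK.le (O₁ * (L : ℝ) ^ 3 * B₃ * ε₁) V,
              IsMinOn (fun W : GaugeField (F.P K) 0 (Matrix.specialUnitaryGroup (Fin 2) ℂ) => wilsonAction4 W)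
                (regFibrePr F n K hnK.le (O₁ * (L : ℝ) ^ 3 * B₃ * ε₁) V) U)
    (h2P : ∀ (L : ℕ), Odd L → 1 < L →
      ∃ (b₁ p₁' : ℝ), ∀ (b₀ p₀ : ℝ), b₁ ≤ b₀ → p₁' ≤ p₀ →
        ∃ (𝔠 : Summit.QuantumFields.Balaban3D.Proofs.Primitives.AlphaConsts L (Summit.QuantumFields.Balaban3D.Carriers.suGroupModel 2).N) (a₀ a₁ : ℝ),
          𝔠.b₀ = b₀ ∧ 𝔠.p₀ = p₀ ∧ 0 < a₀ ∧ 0 < a₁ ∧ 𝔠.B₃ * a₁ ≤ a₀ ∧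
          (∀ (F : T3Family) (hF : F.L = L), Summit.QuantumFields.YangMills.Theorems.AlphaInputsT3AC.OfV4ChiAt F (hF ▸ 𝔠) a₀ a₁) ∧
          ((L < 𝔠.M₁ ∧
            ∀ (sel : (F : T3Family) → (K b : ℕ) → Set (Site (F.P K) 0) → Site (F.P K) b),
              (∀ (F : T3Family) (K b : ℕ) (Y : Set (Site (F.P K) 0)), sel F K b Y ∈ anchors K b Y) →
              (∀ (F : T3Family) (K b : ℕ) (Y : Set (Site (F.P K) 0)), sel F (K + 1) (b + 1) (refineSet F K Y) = liftSite F K b (sel F K b Y)) →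
            ∃ a : ℝ, 0 < a ∧ a < 1 ∧ ∃ p₁ : ℝ, 𝔠.p₀ + 𝔠.r₀ ≤ p₁ ∧
          ∃ (κ' κ₁ R C₀ A₁ A b C_f C_N γB : ℝ), 0 < κ' ∧ κ' < κ₁ ∧ 0 ≤ C₀ ∧ 0 ≤ A₁ ∧ 0 ≤ A ∧ 2 ≤ b ∧ a + 1 ≤ b ∧ 0 ≤ C_f ∧ 0 < γB ∧
            ∀ (F : T3Family) (γ : ℝ) (hF : F.L = L) (hγ : 0 < γ), γ ≤ γB → ∀ (hγ1 : γ ≤ (min (hF ▸ 𝔠).gamma0 1) ^ 2),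
              AlphaInputsT3AC.OfV4ChiAt F (hF ▸ 𝔠) a₀ a₁ →
                ∃ (p : ∀ K, AlphaInputsT3AC.PkgAtV4Chi F (hF ▸ 𝔠) γ hγ hγ1 K), (∀ K, (p K).a₀ = a₀ ∧ (p K).a₁ = a₁) ∧
                  ∃ (N : (K b : ℕ) → Site (F.P K) (1 + b) → (n : ℕ) → (Fin n → PBond (F.P K) b) →
                      ContinuousMultilinearMap ℂ (fun _ : Fin n => ↥(lieC (suGroupModel 2))) ℂ),
                    (∀ (K k : ℕ), k + 1 ≤ K → ∀ j : ℕ, j < k →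
                      ∀ y ∈ oldBlocks (hF ▸ 𝔠).lane.carrier.M₁ (rcolOf (SK F (hF ▸ 𝔠) γ hγ hγ1 K) (hF ▸ 𝔠).lane.carrier) (Hist.triv (F.P K) (k + 1)) (1 + j),
                        ∀ W : GaugeField (F.P K) (k + 1) (Matrix.specialUnitaryGroup (Fin 2) ℂ),
                          oldTermRows (fun K => (p K).toRows) K k (1 + j) y W =
                            (∑ n ∈ Finset.Ico 2 7, ((n ! : ℂ))⁻¹ * ∑ c : Fin n → PBond (F.P K) j, N K j y n c (fun i =>
                              (fun K k b Y W c =>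
                                if h : b + 1 = k then birthCfgAtRows (fun K => (p K).toRows) K b Y (h ▸ W) c
                                else if (l1 (rel (sel F K b Y) c.src) : ℝ) *
                                    (2 * ((hF ▸ 𝔠).B₃ * θBal F.L γ (hF ▸ 𝔠).b₀ p₁ (K - k)) * (((F.L : ℝ) ^ (k - b))⁻¹) ^ 2) ≤ 1 / 2 then
                                  (lieC (suGroupModel 2)).orthogonalProjectionOnto
                                    (vecE (suGroupModel 2).N
                                      (B27T (unitsField (toUField (Averaging.iter (fun i => BlockAveraging.blockAvg (P := F.P K) (j := i) ℰp) b
                                        ((p K).UkH k (Hist.triv (F.P K) k) W)))) (sel F K b Y) c))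
                                else 0) K (k + 1) j (blockSet K (1 + j) y) W (c i))).re) ∧
                    -- (K_b) the two-run kernel row of the BIRTH charts off the blocks (record level)
                    (∀ (K k b : ℕ) (Y : Set (Site (F.P K) 0)), Y ∈ canonLocRows (fun K => (p K).toRows) K k (Hist.triv (F.P K) k) (1 + b) →
                      (∀ y : Site (F.P K) (1 + b), blockSet K (1 + b) y ≠ Y) → ∀ d ∈ Finset.Ico 2 7,
                        ‖(kerT (birthChartRows fun K => (p K).toRows) K b Y d - ker (birthChartRows fun K => (p K).toRows) K b Y d).compContinuousLinearMap
                            fun _ => legL ↥(lieC (suGroupModel 2)) (canonLegDist F) κ' K b Y‖ ≤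
                          C₀ * Real.exp (-(hF ▸ 𝔠).κ * (AlphaInputsT3AC.dataOfV4chi p (canonPolymerRows fun K => (p K).toRows)).treeLen K (1 + b) Y) *
                            (((F.L : ℝ) ^ (1 + b))⁻¹) ^ a) ∧
                    -- (K₀) print's KERNELS ACROSS THE TWO CUT-OFFS, pointwise ([King1986] Prop. 3.6's shape) — UNPRINTED for non-abelian d = 3
                    (∀ (K k b : ℕ) (y : Site (F.P K) (1 + b)), blockSet K (1 + b) y ∈ canonLocRows (fun K => (p K).toRows) K k (Hist.triv (F.P K) k) (1 + b) →
                      ∀ n ∈ Finset.Ico 2 7, ∀ c : Fin n → PBond (F.P K) b,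
                        ‖N (K + 1) (b + 1) (liftSite F K (1 + b) y) n (fun i => matchBond F K b (c i)) - N K b y n c‖ ≤
                          A₁ * (∏ i, Real.exp (-(κ₁ * canonLegDist F K b (blockSet K (1 + b) y) (c i)))) * (((F.L : ℝ) ^ (1 + b))⁻¹) ^ a) ∧
                    -- (ℓ) locality of the retained charts at leg distance `R`
                    (∀ (K b : ℕ), b + 1 ≤ K → ∀ X ∈ newDomsRows (fun K => (p K).toRows) K b (Hist.triv (F.P K) (b + 1)),
                      ∀ z : PBond (F.P K) b → ↥(lieC (suGroupModel 2)),
                        (((p K).toRows).𝔖 b).Ψ X z =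
                          (((p K).toRows).𝔖 b).Ψ X (fun c => if canonLegDist F K b (domSet (F := F) (hF ▸ 𝔠).lane.carrier.M₁ K b X) c ≤ R then z c else 0) ∧
                        (((p K).toRows).𝔄.Λc b).Ψ X z =
                          (((p K).toRows).𝔄.Λc b).Ψ X (fun c => if canonLegDist F K b (domSet (F := F) (hF ▸ 𝔠).lane.carrier.M₁ K b X) c ≤ R then z c else 0)) ∧
                    -- (k₀) print's POINTWISE (43) decay of the kernels at the listed blocks, rate `κ₁ > κ′`
                    (∀ (K k b : ℕ) (y : Site (F.P K) (1 + b)),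
                      blockSet K (1 + b) y ∈ canonLocRows (fun K => (p K).toRows) K k (Hist.triv (F.P K) k) (1 + b) →
                        ∀ n ∈ Finset.Ico 2 7, ∀ c : Fin n → PBond (F.P K) b,
                          ‖N K b y n c‖ ≤ A * ∏ i, Real.exp (-(κ₁ * canonLegDist F K b (blockSet K (1 + b) y) (c i)))) ∧
                    -- (New) the two-run row at the NEW chart level only (both sides are the record's `Bcfg`: B0's coherence)
                    (∀ (K n : ℕ) (h : n ≤ K), ∀ j : ℕ, j < K - n → j + 1 = K - n → ∀ V : GaugeField (F.P n) 0 (Matrix.specialUnitaryGroup (Fin 2) ℂ), PlaqSmall (θBal F.L γ (hF ▸ 𝔠).b₀ p₁ n) V →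
              ∀ Y ∈ (AlphaInputsT3AC.dataOfV4chi p (canonPolymerRows fun K => (p K).toRows)).Loc K (K - n)
                ((AlphaInputsT3AC.dataOfV4chi p (canonPolymerRows fun K => (p K).toRows)).triv K (K - n)) (1 + j), ∀ c : PBond (F.P K) j,
                ‖(fun K k b Y W c =>
              if h : b + 1 = k then birthCfgAtRows (fun K => (p K).toRows) K b Y (h ▸ W) c
              else if (l1 (rel (sel F K b Y) c.src) : ℝ) * (2 * ((hF ▸ 𝔠).B₃ * θBal F.L γ (hF ▸ 𝔠).b₀ p₁ (K - k)) * (((F.L : ℝ) ^ (k - b))⁻¹) ^ 2) ≤ 1 / 2 then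
                (lieC (suGroupModel 2)).orthogonalProjectionOnto (vecE (suGroupModel 2).N (B27T (unitsField (toUField
                  (Averaging.iter (fun i => BlockAveraging.blockAvg (P := F.P K) (j := i) ℰp) b ((p K).UkH k (Hist.triv (F.P K) k) W)))) (sel F K b Y) c))
              else 0) (K + 1) (K + 1 - n) (j + 1) (refineSet F K Y)
                      (fieldShift (F.sitesPerDir_eq (m := F.m) (K := K + 1) (j := K + 1 - n) (m' := F.m) (K' := n) (j' := 0) (by omega)) V) (matchBond F K j c) -
                    (fun K k b Y W c =>
              if h : b + 1 = k then birthCfgAtRows (fun K => (p K).toRows) K b Y (h ▸ W) c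
              else if (l1 (rel (sel F K b Y) c.src) : ℝ) * (2 * ((hF ▸ 𝔠).B₃ * θBal F.L γ (hF ▸ 𝔠).b₀ p₁ (K - k)) * (((F.L : ℝ) ^ (k - b))⁻¹) ^ 2) ≤ 1 / 2 then
                (lieC (suGroupModel 2)).orthogonalProjectionOnto (vecE (suGroupModel 2).N (B27T (unitsField (toUField
                  (Averaging.iter (fun i => BlockAveraging.blockAvg (P := F.P K) (j := i) ℰp) b ((p K).UkH k (Hist.triv (F.P K) k) W)))) (sel F K b Y) c))
              else 0) K (K - n) j Y
                      (fieldShift (F.sitesPerDir_eq (m := F.m) (K := K) (j := K - n) (m' := F.m) (K' := n) (j' := 0) (by omega)) V) c‖ ≤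
                  C_N * (1 + canonLegDist F K j Y c) * θBal F.L γ (hF ▸ 𝔠).b₀ p₁ n * (((F.L : ℝ) ^ (K - n - 1 - j))⁻¹) ^ 2 * (((F.L : ℝ) ^ (1 + j))⁻¹) ^ a) ∧
                    -- (Fine_b) the two fine backgrounds of runs `K`, `K+1` are close in the BONDWISE SUP distance on run `K`'s finest lattice
                    (∀ (K n : ℕ) (h : n ≤ K), 1 < K - n → ∀ V : GaugeField (F.P n) 0 (Matrix.specialUnitaryGroup (Fin 2) ℂ), PlaqSmall (θBal F.L γ (hF ▸ 𝔠).b₀ p₁ n) V →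
              (⨆ e' : PBond (F.P K) 0, ‖(((p K).UkH (K - n) (Hist.triv (F.P K) (K - n)) (fieldShift (F.sitesPerDir_eq (m := F.m) (K := K) (j := K - n) (m' := F.m) (K' := n) (j' := 0) (by omega)) V) e' : Matrix.specialUnitaryGroup (Fin 2) ℂ) : Matrix (Fin 2) (Fin 2) ℂ) -
                  ((fieldShift (F.sitesPerDir_eq (m := F.m) (K := K) (j := 0) (m' := F.m) (K' := K + 1) (j' := 1) (by omega)) ((BlockAveraging.blockAvg (P := F.P (K + 1)) (j := 0) ℰp).avg
                      ((p (K + 1)).UkH (K + 1 - n) (Hist.triv (F.P (K + 1)) (K + 1 - n)) (fieldShift (F.sitesPerDir_eq (m := F.m) (K := K + 1) (j := K + 1 - n) (m' := F.m) (K' := n) (j' := 0) (by omega)) V))) e' : Matrix.specialUnitaryGroup (Fin 2) ℂ) : Matrix (Fin 2) (Fin 2) ℂ)‖) ≤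
                C_f * θBal F.L γ (hF ▸ 𝔠).b₀ p₁ n * (((F.L : ℝ) ^ (K - n))⁻¹) ^ b)) ∨
           (∃ a : ℝ, 0 < a ∧ a < 1 ∧ ∃ p₁ : ℝ, 𝔠.p₀ + 𝔠.r₀ ≤ p₁ ∧ K1aLegRowsDisplayTwoRunChiAtV4 L 𝔠 a₀ a₁ a p₁))) :
    FluctuationComparisonRegPrIntL :=
  regPrIntL_of_halving_exist_recChiV4WithPrintRowsLip_allL
    Summit.QuantumFields.YangMills.Theorems.MinimiserStabilityRegPrStubHalvingStep.stub_halvingStep hEX h2P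

end Summit.QuantumFields.YangMills.Theorems.InteriorExcision

end
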